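import Summits.AnomalousDissipation.AnomalousDissipation.Theses.TwoAndHalfD
import Literature.Analysis.FluidPDE.PassiveScalarClassicalEnergy
import Literature.Analysis.FluidPDE.PassiveScalarEnergySlice
import Literature.Analysis.FluidPDE.PassiveScalarForced
import Literature.Analysis.FluidPDE.TimeAverageMeasureBasic
import Literature.Analysis.FluidPDE.LongTimeAverageSubadditive
import Literature.Analysis.FluidPDE.LongTimeAverageNonneg
import Summits.AnomalousDissipation.AnomalousDissipation.Theorems.TwoAndHalfDScalarAnomalySteadySourceFormalColdStartVarianceToolkit

/-!
# D2 `stub_dissipationFloor`: the dissipation floor from a liminf-mean input-power floor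

Stub D2 of the line `Sketch` (duhamel-release) for the crux
`Summit.AnomalousDissipation.AnomalousDissipation.Theses.TwoAndHalfD.TwohalfdThesis`
(stmt-AnomalousDissipation-0206); the statement is registered verbatim in the line's checked
skeleton and is consumed by the kernel-checked composition there.

CONTENT. Let `θ` be a classical solution of the sourced advection–diffusion equation
`∂ₜθ + u·∇θ = κΔθ + h` on `[0, ∞) × T²` with bounded variance `‖θ(t)‖²_{L²} ≤ B` (`t ≥ 0`) and a
liminf floor `ε ≤ liminf_T T⁻¹∫₀ᵀ P`, `P(t) := ∫ h θ(t)` (input power). Then the limsup-mean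
dissipation `⟨κ‖∇θ‖²⟩ = limsup_T T⁻¹∫₀ᵀ κ‖∇θ(t)‖²` (spectral gradient norm
`Torus.eScalarGradNormSq`, `toReal`) is `≥ ε`.

PROOF. (1) The sourced `L²` balance `d/dt ‖θ(t)‖² = -2κ‖∇θ(t)‖² + 2P(t)` within `[0, ∞)`
(`ColdStartVariance.forced_hasDerivWithinAt_scalarL2Sq`) integrates by the fundamental theorem of
calculus (both terms of the right-hand side are continuous in time) to
`T⁻¹∫₀ᵀ κ‖∇θ‖² = T⁻¹∫₀ᵀ P - (‖θ(T)‖² - ‖θ(0)‖²)/(2T)` for `T > 0`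
(`dissipationFloor_timeMean_eq`; the spectral and classical gradient norms agree on smooth slices,
`Torus.scalarGradNormSq_eq_toReal_holds`). (2) Hence the dissipation means are
`≥ T⁻¹∫₀ᵀ P - B/(2T)` and `≤ ‖h‖√B + B/(2T)` (Cauchy–Schwarz `|P| ≤ ‖h‖√B`). (3) Real-variable
bookkeeping (`dissipationFloor_le_limsup`): the power means are bounded, so
`Filter.eventually_lt_of_lt_liminf` makes them eventually `> ε - δ/2`, while `B/(2T) < δ/2`
eventually; the dissipation means are bounded above, so `Filter.le_limsup_of_frequently_le` gives
`ε - δ ≤ limsup`, for every `δ > 0`.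
Supports stmt-AnomalousDissipation-0206. [folklore: Doering–Foias 2002, §2 (power balance in
Cesàro form); DEIJ 2022, (1.2)]
-/

noncomputable section

-- the summit path `AnomalousDissipation/AnomalousDissipation` duplicates a namespace component
set_option linter.dupNamespace false

namespace Summit.AnomalousDissipation.AnomalousDissipation.Theorems.TwohalfdThesis

open MeasureTheory Set Filter Topology
open scoped ENNReal NNReal InnerProductSpace
open Literature.Analysis.FunctionSpaces Literature.Analysis.FluidPDE

/-! ## Real-variable bookkeeping: from a liminf floor to a limsup floor -/

/-- **Cesàro bookkeeping.** If `m T - B/(2T) ≤ n T ≤ K + B/(2T)` for `T > 0`, `|m T| ≤ K` for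
`T > 0`, `B ≥ 0` and `ε ≤ liminf m`, then `ε ≤ limsup n` (all along `atTop` in `ℝ`; the bounds
make both the `liminf` and the `limsup` honest): for `δ > 0`, eventually `m T > ε - δ/2`
(`Filter.eventually_lt_of_lt_liminf`) and `B/(2T) < δ/2`, so eventually `n T ≥ ε - δ`, whence
`ε - δ ≤ limsup n` (`Filter.le_limsup_of_frequently_le`). [folklore] -/
theorem dissipationFloor_le_limsup {m n : ℝ → ℝ} {ε B K : ℝ} (hB : 0 ≤ B)
    (hlow : ∀ T, 0 < T → m T - B / (2 * T) ≤ n T)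
    (hup : ∀ T, 0 < T → n T ≤ K + B / (2 * T))
    (hm : ∀ T, 0 < T → |m T| ≤ K)
    (hε : ε ≤ liminf m atTop) : ε ≤ limsup n atTop := by
  have hBd : Tendsto (fun T : ℝ => B / (2 * T)) atTop (𝓝 0) :=
    tendsto_const_nhds.div_atTop (tendsto_id.const_mul_atTop two_pos)
  have hm_bdd : IsBoundedUnder (· ≥ ·) atTop m :=
    ⟨-K, (eventually_gt_atTop (0 : ℝ)).mono fun T hT => (abs_le.1 (hm T hT)).1⟩
  have hn_bdd : IsBoundedUnder (· ≤ ·) atTop n := by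
    refine ⟨K + B / 2, (eventually_ge_atTop (1 : ℝ)).mono fun T hT => ?_⟩
    have hT0 : 0 < T := by linarith
    have h1 : B / (2 * T) ≤ B / 2 := div_le_div_of_nonneg_left hB two_pos (by linarith)
    exact (hup T hT0).trans (by linarith)
  refine le_of_forall_pos_le_add fun δ hδ => ?_
  rw [← sub_le_iff_le_add]
  have h1 : ∀ᶠ T in atTop, ε - δ / 2 < m T :=
    eventually_lt_of_lt_liminf (lt_of_lt_of_le (by linarith) hε) hm_bdd
  have h2 : ∀ᶠ T in atTop, B / (2 * T) < δ / 2 := hBd.eventually_lt_const (half_pos hδ)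
  have h3 : ∀ᶠ T in atTop, ε - δ ≤ n T := by
    filter_upwards [h1, h2, eventually_gt_atTop (0 : ℝ)] with T hT1 hT2 hT0
    linarith [hlow T hT0]
  exact le_limsup_of_frequently_le h3.frequently hn_bdd

/-! ## The sourced `L²` balance in integrated and Cesàro form -/

/-- The scalar enstrophy `t ↦ ‖∇θ(t)‖²_{L²}` of a jointly smooth field on a convex time set of
unique differentiability is continuous in time (the integrand `‖∇θ‖² = ⟪∇θ, ∇θ⟫` is jointly
smooth; twin of `IsClassicalScalarTransportOn.continuousOn_scalarGradNormSq`). [folklore] -/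
theorem dissipationFloor_continuousOn_scalarGradNormSq {d : Type*} [Fintype d] [DecidableEq d]
    {S : Set ℝ} {θ : ℝ → UnitAddTorus d → ℝ} (hθ : Torus.IsSmoothSpaceTimeOn S θ)
    (hS : Convex ℝ S) (hU : UniqueDiffOn ℝ S) :
    ContinuousOn (fun t => Torus.scalarGradNormSq (θ t)) S := by
  have hg := hθ.gradient hU
  have hc := (hg.inner hg).continuousOn_integral hS
  refine hc.congr fun t _ => ?_
  simp only [Torus.scalarGradNormSq, real_inner_self_eq_norm_sq]

/-- **Integrated sourced balance.** For a classical solution of `∂ₜθ + u·∇θ = κΔθ + h` on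
`[0, ∞) × T^d` (steady source `h`) and `T ≥ 0`,
`‖θ(T)‖² - ‖θ(0)‖² = -2κ∫₀ᵀ‖∇θ(t)‖² dt + 2∫₀ᵀ ∫ h θ(t) dt`: the balance
`ColdStartVariance.forced_hasDerivWithinAt_scalarL2Sq` within `[0, ∞)` and the fundamental theorem
of calculus on `[0, T]`, both terms of the derivative being continuous in time (Doering–Foias
2002, §2; DEIJ 2022, (1.2)–(1.3) with a source). [folklore] -/
theorem dissipationFloor_balance {d : Type*} [Fintype d] [DecidableEq d] {κ : ℝ}
    {u : ℝ → UnitAddTorus d → EuclideanSpace ℝ d} {h : UnitAddTorus d → ℝ}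
    {θ : ℝ → UnitAddTorus d → ℝ}
    (hθ : Torus.IsClassicalScalarTransportForcedOn (Ici 0) κ u (fun _ => h) θ) {T : ℝ}
    (hT : 0 ≤ T) :
    Torus.scalarL2Sq (θ T) - Torus.scalarL2Sq (θ 0) =
      -(2 * κ) * (∫ t in (0 : ℝ)..T, Torus.scalarGradNormSq (θ t)) +
        2 * ∫ t in (0 : ℝ)..T, ∫ x, h x * θ t x := by
  have hconv : Convex ℝ (Ici (0 : ℝ)) := convex_Ici 0
  have hU : UniqueDiffOn ℝ (Ici (0 : ℝ)) := uniqueDiffOn_Ici 0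
  have hP : ∀ t, (∫ x, θ t x * h x) = ∫ x, h x * θ t x := fun t =>
    integral_congr_ae (ae_of_all _ fun x => mul_comm _ _)
  have hder : ∀ t ∈ Ici (0 : ℝ), HasDerivWithinAt (fun τ => Torus.scalarL2Sq (θ τ))
      (-(2 * κ) * Torus.scalarGradNormSq (θ t) + 2 * ∫ x, h x * θ t x) (Ici 0) t := by
    intro t ht
    have h1 := ScalarAnomalySteadySourceFormal.ColdStartVariance.forced_hasDerivWithinAt_scalarL2Sq
      hθ hconv ht
    refine h1.congr_deriv ?_
    rw [hP t]
  have hGc : ContinuousOn (fun t => Torus.scalarGradNormSq (θ t)) (Ici 0) :=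
    dissipationFloor_continuousOn_scalarGradNormSq hθ.smooth_scalar hconv hU
  have hPc : ContinuousOn (fun t => ∫ x, h x * θ t x) (Ici 0) :=
    (hθ.smooth_source.mul hθ.smooth_scalar).continuousOn_integral hconv
  have hsub : uIcc 0 T ⊆ Ici 0 := by
    rw [uIcc_of_le hT]
    exact Icc_subset_Ici_self
  have hGi : IntervalIntegrable (fun t => Torus.scalarGradNormSq (θ t)) volume 0 T :=
    (hGc.mono hsub).intervalIntegrable
  have hPi : IntervalIntegrable (fun t => ∫ x, h x * θ t x) volume 0 T :=
    (hPc.mono hsub).intervalIntegrable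
  have hFTC : ∫ t in (0 : ℝ)..T,
      (-(2 * κ) * Torus.scalarGradNormSq (θ t) + 2 * ∫ x, h x * θ t x) =
        Torus.scalarL2Sq (θ T) - Torus.scalarL2Sq (θ 0) :=
    intervalIntegral.integral_eq_sub_of_hasDerivAt_of_le hT
      (fun t ht => ((hder t (mem_Ici.2 ht.1)).continuousWithinAt).mono Icc_subset_Ici_self)
      (fun t ht => (hder t (mem_Ici.2 ht.1.le)).hasDerivAt (Ici_mem_nhds ht.1))
      ((hGi.const_mul (-(2 * κ))).add (hPi.const_mul 2))
  rw [← hFTC, intervalIntegral.integral_add (hGi.const_mul (-(2 * κ))) (hPi.const_mul 2),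
    intervalIntegral.integral_const_mul, intervalIntegral.integral_const_mul]

/-- **Sourced balance in Cesàro form.** For a classical solution of `∂ₜθ + u·∇θ = κΔθ + h` on
`[0, ∞) × T^d` and `T > 0`,
`T⁻¹∫₀ᵀ κ‖∇θ(t)‖² dt = T⁻¹∫₀ᵀ ∫ h θ(t) dt - (‖θ(T)‖² - ‖θ(0)‖²)/(2T)`, the dissipation being
measured with the spectral gradient norm `Torus.eScalarGradNormSq` (equal to the classical one on
the smooth slices `θ(t)`, `t ≥ 0`, `Torus.scalarGradNormSq_eq_toReal_holds`; Doering–Foias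
2002, §2). [folklore] -/
theorem dissipationFloor_timeMean_eq {d : Type*} [Fintype d] [DecidableEq d] {κ : ℝ}
    {u : ℝ → UnitAddTorus d → EuclideanSpace ℝ d} {h : UnitAddTorus d → ℝ}
    {θ : ℝ → UnitAddTorus d → ℝ}
    (hθ : Torus.IsClassicalScalarTransportForcedOn (Ici 0) κ u (fun _ => h) θ) {T : ℝ}
    (hT : 0 < T) :
    timeMean (fun t => κ * (Torus.eScalarGradNormSq (θ t)).toReal) T =
      timeMean (fun t => ∫ x, h x * θ t x) T -
        (Torus.scalarL2Sq (θ T) - Torus.scalarL2Sq (θ 0)) / (2 * T) := by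
  have heq : ∀ t, 0 < t →
      κ * (Torus.eScalarGradNormSq (θ t)).toReal = κ * Torus.scalarGradNormSq (θ t) := by
    intro t ht
    rw [Torus.scalarGradNormSq_eq_toReal_holds (hθ.smooth_scalar.isSmooth_slice (mem_Ici.2 ht.le))]
  rw [timeMean_congr heq hT.le]
  have hbal := dissipationFloor_balance hθ hT.le
  unfold timeMean
  rw [intervalIntegral.integral_const_mul]
  have hκ : κ * (∫ t in (0 : ℝ)..T, Torus.scalarGradNormSq (θ t)) =
      (∫ t in (0 : ℝ)..T, ∫ x, h x * θ t x) -
        (Torus.scalarL2Sq (θ T) - Torus.scalarL2Sq (θ 0)) / 2 := by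
    linarith
  rw [hκ]
  ring

/-! ## The stub -/

/-- **D2 `stub_dissipationFloor` (line `Sketch` = duhamel-release, crux `TwoAndHalfD.TwohalfdThesis`).**
For a classical solution `θ` of `∂ₜθ + u·∇θ = κΔθ + h` on `[0, ∞) × T²` (`κ ≥ 0`, `h` smooth) with
`‖θ(t)‖²_{L²} ≤ B` for `t ≥ 0` and a liminf-mean input-power floor
`ε ≤ liminf_T T⁻¹∫₀ᵀ ∫ h θ(t)`, the limsup-mean dissipation `⟨κ‖∇θ‖²⟩` (spectral gradient norm,
`toReal`) is `≥ ε`: the sourced `L²` balance in Cesàro form (`dissipationFloor_timeMean_eq`)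
gives `T⁻¹∫₀ᵀ κ‖∇θ‖² ≥ T⁻¹∫₀ᵀ ∫ h θ - B/(2T)` and `≤ ‖h‖√B + B/(2T)` (Cauchy–Schwarz), and the
real-variable bookkeeping `dissipationFloor_le_limsup` concludes (Doering–Foias 2002, §2).
[folklore] -/
theorem stub_dissipationFloor : ∀ (κ B ε : ℝ) (u : ℝ → (UnitAddTorus (Fin 2)) → (EuclideanSpace ℝ (Fin 2))) (h : (UnitAddTorus (Fin 2)) → ℝ) (θ : ℝ → (UnitAddTorus (Fin 2)) → ℝ), 0 ≤ κ → Torus.IsSmooth h → Torus.IsClassicalScalarTransportForcedOn (Ici 0) κ u (fun _ => h) θ → (∀ t, 0 ≤ t → Torus.scalarL2Sq (θ t) ≤ B) → ε ≤ liminf (timeMean fun t => ∫ x, h x * θ t x) atTop → ε ≤ longTimeAvgSup (fun t => κ * (Torus.eScalarGradNormSq (θ t)).toReal) := by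
  intro κ B ε u h θ _ hh hθ hB hε
  have hB0 : 0 ≤ B := (Torus.scalarL2Sq_nonneg (θ 0)).trans (hB 0 le_rfl)
  -- Cauchy–Schwarz: the input power is bounded by `‖h‖ √B` on `[0, ∞)`
  have hPle : ∀ t, 0 ≤ t → |∫ x, h x * θ t x| ≤ √(Torus.scalarL2Sq h) * √B := by
    intro t ht
    have hθt : Torus.IsSmooth (θ t) := hθ.smooth_scalar.isSmooth_slice (mem_Ici.2 ht)
    have h1 := ScalarAnomalySteadySourceFormal.ColdStartVariance.integral_mul_le_sqrt_mul_sqrt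
      (hh.memLp 2) (hθt.memLp 2)
    have h2 := ScalarAnomalySteadySourceFormal.ColdStartVariance.integral_mul_le_sqrt_mul_sqrt
      (hh.memLp 2).neg (hθt.memLp 2)
    simp only [Pi.neg_apply, neg_mul, integral_neg, neg_sq] at h2
    have h3 : √(∫ x, h x ^ 2) * √(∫ x, θ t x ^ 2) ≤ √(Torus.scalarL2Sq h) * √B :=
      mul_le_mul_of_nonneg_left (Real.sqrt_le_sqrt (hB t ht)) (Real.sqrt_nonneg _)
    rw [abs_le]
    exact ⟨by linarith, by linarith⟩
  have hm : ∀ T, 0 < T →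
      |timeMean (fun t => ∫ x, h x * θ t x) T| ≤ √(Torus.scalarL2Sq h) * √B :=
    fun T hT => abs_timeMean_le hT fun t ht _ => hPle t ht.le
  -- the Cesàro-form balance, bounded variance: lower and upper bounds on the dissipation means
  have hlow : ∀ T, 0 < T → timeMean (fun t => ∫ x, h x * θ t x) T - B / (2 * T) ≤
      timeMean (fun t => κ * (Torus.eScalarGradNormSq (θ t)).toReal) T := by
    intro T hT
    rw [dissipationFloor_timeMean_eq hθ hT]
    have h1 : Torus.scalarL2Sq (θ T) - Torus.scalarL2Sq (θ 0) ≤ B := by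
      linarith [hB T hT.le, Torus.scalarL2Sq_nonneg (θ 0)]
    have h2 : (Torus.scalarL2Sq (θ T) - Torus.scalarL2Sq (θ 0)) / (2 * T) ≤ B / (2 * T) :=
      div_le_div_of_nonneg_right h1 (by positivity)
    linarith
  have hup : ∀ T, 0 < T → timeMean (fun t => κ * (Torus.eScalarGradNormSq (θ t)).toReal) T ≤
      √(Torus.scalarL2Sq h) * √B + B / (2 * T) := by
    intro T hT
    rw [dissipationFloor_timeMean_eq hθ hT]
    have h1 : Torus.scalarL2Sq (θ 0) - Torus.scalarL2Sq (θ T) ≤ B := by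
      linarith [hB 0 le_rfl, Torus.scalarL2Sq_nonneg (θ T)]
    have h2 : (Torus.scalarL2Sq (θ 0) - Torus.scalarL2Sq (θ T)) / (2 * T) ≤ B / (2 * T) :=
      div_le_div_of_nonneg_right h1 (by positivity)
    have h3 : timeMean (fun t => ∫ x, h x * θ t x) T ≤ √(Torus.scalarL2Sq h) * √B :=
      (le_abs_self _).trans (hm T hT)
    have h4 : (Torus.scalarL2Sq (θ 0) - Torus.scalarL2Sq (θ T)) / (2 * T) =
        -((Torus.scalarL2Sq (θ T) - Torus.scalarL2Sq (θ 0)) / (2 * T)) := by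
      ring
    linarith
  unfold longTimeAvgSup
  exact dissipationFloor_le_limsup hB0 hlow hup hm hε

end Summit.AnomalousDissipation.AnomalousDissipation.Theorems.TwohalfdThesis

end
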